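import Mathlib
import HarnessLib
import Summits.HubbardSuperconductivity.HubbardSuperconductivity.Theses.KLProgramme

/-!
# Route `KLProgramme`, crux K1 `H10TwoPointLimit` (stmt-HubbardSuperconductivity-19938): the registered stub
# `stub_MuOfDopingWindow` of the birth skeleton, SERVED by name

The K1 skeleton (`H10TwoPointLimit_of`, skeleton 32b7d1db70b0) has five registered stubs: `stub_CountPairsOffset`, `stub_H10_mu_of_count`,
`stub_MuOfDopingWindow : …Theses.KLProgramme.MuOfDopingWindow`, `stub_H10RungCompactBox`, `stub_H10RungBetaUCorner`.
`stub_MuOfDopingWindow` is the route's support statement S0 (item stmt-…-19939), CLOSED `proved` by seat eng's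
`Summit.HubbardSuperconductivity.HubbardSuperconductivity.Theorems.muOfDopingWindow_proof` (the route file records it as
`MuOfDopingWindow_holds`). This file only restates that closed fact under the stub's registered name and signature, so that the
K1 skeleton's ledger shows the S0 input as served (cell gate-hubbard-kl, seat fs-1 g7, «coordinate S0 with eng — one owner, cite
the other»: the proof is eng's, cited by name; nothing is re-derived). [folklore]
-/

namespace Summit.HubbardSuperconductivity.HubbardSuperconductivity.Theorems.H10TwoPointLimitStubs

set_option linter.dupNamespace false -- summit = problem name (single-conjunct summit), D-0017

/-- **Stub `stub_MuOfDopingWindow` of the K1 skeleton**: `∀ δ ∈ [0.10, 0.35], μ(δ) ∈ [-1, -0.15]` — the route decl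
`MuOfDopingWindow`, by eng's `muOfDopingWindow_proof` (item stmt-…-19939, via the route file's `MuOfDopingWindow_holds`). [folklore] -/
theorem stub_MuOfDopingWindow : Summit.HubbardSuperconductivity.HubbardSuperconductivity.Theses.KLProgramme.MuOfDopingWindow :=
  Summit.HubbardSuperconductivity.HubbardSuperconductivity.Theses.KLProgramme.MuOfDopingWindow_holds

end Summit.HubbardSuperconductivity.HubbardSuperconductivity.Theorems.H10TwoPointLimitStubs
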